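import Mathlib
import Summits.Ventures.PercRepro2.Defs
import Summits.Ventures.PercRepro2.Independence
import Summits.Ventures.PercRepro2.Harris
import Summits.Ventures.PercRepro2.Graph
import Summits.Ventures.PercRepro2.Exploration
import Summits.Ventures.PercRepro2.Events
import Summits.Ventures.PercRepro2.Induced
import Summits.Ventures.PercRepro2.BHKEvents
import Summits.Ventures.PercRepro2.BHKAvoid
import Summits.Ventures.PercRepro2.R4Defs
import Summits.Ventures.PercRepro2.R4Plus
import Summits.Ventures.PercRepro2.R4Ladder
import Summits.Ventures.PercRepro2.R4Ladder2
import Summits.Ventures.PercRepro2.StarRoot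
import Summits.Ventures.PercRepro2.StarCells
import Summits.Ventures.PercRepro2.StarProb
import Summits.Ventures.PercRepro2.StarLoss

/-!
# The star-attached root theorem (blind cell PercRepro2, p1)

**Theorem** (LEAD-PROOFSHAPES §8.7 (9)). If every edge at `o` ends in `{a₁, a₂, b}` then (H2′)
holds under the order hypothesis: `LOSS(a₁) ≤ PAX`. With the closed forms of `StarProb.lean`
and `StarLoss.lean` (`α, β, γ` the hit probabilities of `a₂, b, a₁` from `o`; `P₀, P₁, P₂` the
probabilities of the states `S₀`: none of `a₁, a₂, b` connected in `G − o`, `S₁`: `a₂ ↔ b ≁ a₁`,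
`S₂`: `a₁ ↔ b ≁ a₂`):

* `PAX = (x₁₁ x₀₀ − x₁₀ x₀₁)/(x₁₀ + x₀₀)` with
  `x₁₁ x₀₀ − x₁₀ x₀₁ = (1−α)(1−γ)(P₀+P₂) β [P₁(1 + α(1−β)) + P₀ α]` and
  `x₁₀ + x₀₀ = (P₀+P₂) K`, `K = 1 − α(β + γ − βγ)`;
* `LOSS = (1−α)(1−β)(1−γ)(P₂ − P₁)⁺`;
* the order hypothesis reads `(P₂ − P₁) K ≤ β(α − γ)(P₀ + P₁)`.

When `P₂ ≤ P₁` the claim is `PAX ≥ 0`; otherwise multiply the order hypothesis by `1 − β` and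
use `(1−β)(α−γ) ≤ α ≤ 1 + α(1−β)`. The degenerate targets `b = a₂`, `b = a₁` (allowed by the
closure `StarTheorem_all`) have `LOSS = 0 ≤ PAX` resp. `LOSS ≤ 0 = PAX` directly.
-/

namespace Summit.Ventures.PercRepro2

section StarAlgebra

variable {R : Type*} [Field R] [LinearOrder R] [IsStrictOrderedRing R]

/-- `(1−β)(α−γ) ≤ α` for `α, β, γ ∈ [0, 1]`. -/
lemma star_aux_e1 {α β γ : R} (hα0 : 0 ≤ α) (hβ0 : 0 ≤ β) (hβ1 : β ≤ 1) (hγ0 : 0 ≤ γ) :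
    (1 - β) * (α - γ) ≤ α := by
  have h1 := mul_nonneg (sub_nonneg.2 hβ1) hγ0
  have h2 := mul_nonneg hα0 hβ0
  linarith

/-- `α ≤ 1 + α(1−β)` for `α, β ∈ [0, 1]`. -/
lemma star_aux_e2 {α β : R} (hα1 : α ≤ 1) (hβ0 : 0 ≤ β) (hβ1 : β ≤ 1) :
    α ≤ 1 + α * (1 - β) := by
  have : α * β ≤ 1 := mul_le_one₀ hα1 hβ0 hβ1
  linarith

/-- The comparison `(1−β) β (α−γ)(P₀+P₁) ≤ β [P₁(1 + α(1−β)) + P₀ α]`. -/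
lemma star_aux_h2 {α β γ P₀ P₁ : R} (hα0 : 0 ≤ α) (hα1 : α ≤ 1) (hβ0 : 0 ≤ β) (hβ1 : β ≤ 1)
    (hγ0 : 0 ≤ γ) (hP₀ : 0 ≤ P₀) (hP₁ : 0 ≤ P₁) :
    (1 - β) * (β * (α - γ) * (P₀ + P₁)) ≤ β * (P₁ * (1 + α * (1 - β)) + P₀ * α) := by
  have e1 := star_aux_e1 hα0 hβ0 hβ1 hγ0
  have e2 := star_aux_e2 hα1 hβ0 hβ1
  have e3 : (1 - β) * (α - γ) * P₀ ≤ α * P₀ := mul_le_mul_of_nonneg_right e1 hP₀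
  have e4 : (1 - β) * (α - γ) * P₁ ≤ (1 + α * (1 - β)) * P₁ :=
    mul_le_mul_of_nonneg_right (e1.trans e2) hP₁
  have e5 := mul_le_mul_of_nonneg_left e3 hβ0
  have e6 := mul_le_mul_of_nonneg_left e4 hβ0
  linarith

omit [LinearOrder R] [IsStrictOrderedRing R] in
/-- The determinant `x₁₁ x₀₀ − x₁₀ x₀₁` in closed form. -/
lemma star_det {α β γ P₀ P₁ P₂ x₀₀ x₀₁ x₁₀ x₁₁ : R}
    (h00 : x₀₀ = (1 - α) * (P₀ + P₂)) (h01 : x₀₁ = (1 - α) * (1 - β) * P₁)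
    (h10 : x₁₀ = α * (1 - β) * (1 - γ) * (P₀ + P₂))
    (h11 : x₁₁ = (1 - γ) * (P₁ * (α + β - α * β) + P₀ * (α * β))) :
    x₁₁ * (x₁₀ + x₀₀) - x₁₀ * (x₁₁ + x₀₁) =
      (1 - γ) * (1 - α) * (P₀ + P₂) * β * (P₁ * (1 + α * (1 - β)) + P₀ * α) := by
  rw [h00, h01, h10, h11]; ring

omit [LinearOrder R] [IsStrictOrderedRing R] in
/-- The denominator `x₁₀ + x₀₀ = (P₀ + P₂) K`. -/
lemma star_denom {α β γ P₀ P₂ x₀₀ x₁₀ : R} (h00 : x₀₀ = (1 - α) * (P₀ + P₂))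
    (h10 : x₁₀ = α * (1 - β) * (1 - γ) * (P₀ + P₂)) :
    x₁₀ + x₀₀ = (P₀ + P₂) * (1 - α * (β + γ - β * γ)) := by
  rw [h10, h00]; ring

/-- The order hypothesis in the form `(P₂ − P₁) K ≤ β (α − γ)(P₀ + P₁)`. -/
lemma star_order {α β γ P₀ P₁ P₂ x₀₁ x₁₁ : R} (h01 : x₀₁ = (1 - α) * (1 - β) * P₁)
    (h11 : x₁₁ = (1 - γ) * (P₁ * (α + β - α * β) + P₀ * (α * β)))
    (hord : (1 - α) * (P₂ * (γ + β - γ * β) + P₀ * (γ * β)) + (1 - γ) * (1 - β) * P₂ ≤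
      x₁₁ + x₀₁) :
    (P₂ - P₁) * (1 - α * (β + γ - β * γ)) ≤ β * (α - γ) * (P₀ + P₁) := by
  rw [h11, h01] at hord
  linarith

/-- The main case of the star inequality, positive denominator and `P₂ > P₁`:
`(1−α)(1−β)(1−γ)(P₂ − P₁) · (x₁₀ + x₀₀) ≤ x₁₁ x₀₀ − x₁₀ x₀₁`. -/
lemma star_main_case {α β γ P₀ P₁ P₂ x₀₀ x₀₁ x₁₀ x₁₁ : R}
    (hα0 : 0 ≤ α) (hα1 : α ≤ 1) (hβ0 : 0 ≤ β) (hβ1 : β ≤ 1) (hγ0 : 0 ≤ γ) (hγ1 : γ ≤ 1)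
    (hP₀ : 0 ≤ P₀) (hP₁ : 0 ≤ P₁) (hP₂ : 0 ≤ P₂)
    (h00 : x₀₀ = (1 - α) * (P₀ + P₂)) (h01 : x₀₁ = (1 - α) * (1 - β) * P₁)
    (h10 : x₁₀ = α * (1 - β) * (1 - γ) * (P₀ + P₂))
    (h11 : x₁₁ = (1 - γ) * (P₁ * (α + β - α * β) + P₀ * (α * β)))
    (hord : (1 - α) * (P₂ * (γ + β - γ * β) + P₀ * (γ * β)) + (1 - γ) * (1 - β) * P₂ ≤
      x₁₁ + x₀₁) :
    (1 - α) * (1 - β) * (1 - γ) * (P₂ - P₁) * (x₁₀ + x₀₀) ≤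
      x₁₁ * (x₁₀ + x₀₀) - x₁₀ * (x₁₁ + x₀₁) := by
  have hK := star_order h01 h11 hord
  have h1 : (1 - β) * ((P₂ - P₁) * (1 - α * (β + γ - β * γ))) ≤
      (1 - β) * (β * (α - γ) * (P₀ + P₁)) := mul_le_mul_of_nonneg_left hK (sub_nonneg.2 hβ1)
  have h3 := h1.trans (star_aux_h2 hα0 hα1 hβ0 hβ1 hγ0 hP₀ hP₁)
  have hc : 0 ≤ (1 - γ) * (1 - α) * (P₀ + P₂) :=
    mul_nonneg (mul_nonneg (sub_nonneg.2 hγ1) (sub_nonneg.2 hα1)) (add_nonneg hP₀ hP₂)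
  have hmul := mul_le_mul_of_nonneg_left h3 hc
  rw [star_det h00 h01 h10 h11, star_denom h00 h10]
  linarith

/-- The closed-form inequality behind the star-attached root theorem. -/
lemma star_algebra (α β γ P₀ P₁ P₂ x₀₀ x₀₁ x₁₀ x₁₁ : R)
    (hα0 : 0 ≤ α) (hα1 : α ≤ 1) (hβ0 : 0 ≤ β) (hβ1 : β ≤ 1) (hγ0 : 0 ≤ γ) (hγ1 : γ ≤ 1)
    (hP₀ : 0 ≤ P₀) (hP₁ : 0 ≤ P₁) (hP₂ : 0 ≤ P₂)
    (h00 : x₀₀ = (1 - α) * (P₀ + P₂)) (h01 : x₀₁ = (1 - α) * (1 - β) * P₁)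
    (h10 : x₁₀ = α * (1 - β) * (1 - γ) * (P₀ + P₂))
    (h11 : x₁₁ = (1 - γ) * (P₁ * (α + β - α * β) + P₀ * (α * β)))
    (hord : (1 - α) * (P₂ * (γ + β - γ * β) + P₀ * (γ * β)) + (1 - γ) * (1 - β) * P₂ ≤
      x₁₁ + x₀₁) :
    (1 - α) * (1 - β) * (1 - γ) * max 0 (P₂ - P₁) ≤
      x₁₁ - x₁₀ * (x₁₁ + x₀₁) / (x₁₀ + x₀₀) := by
  have hα' : 0 ≤ 1 - α := sub_nonneg.2 hα1
  have hβ' : 0 ≤ 1 - β := sub_nonneg.2 hβ1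
  have hγ' : 0 ≤ 1 - γ := sub_nonneg.2 hγ1
  have hP02 : 0 ≤ P₀ + P₂ := add_nonneg hP₀ hP₂
  -- the bracket of `x₁₁` and the determinant are nonnegative
  have hbr : 0 ≤ P₁ * (α + β - α * β) + P₀ * (α * β) := by
    have h1 := mul_nonneg hβ0 hα'
    have : 0 ≤ α + β - α * β := by linarith
    exact add_nonneg (mul_nonneg hP₁ this) (mul_nonneg hP₀ (mul_nonneg hα0 hβ0))
  have hx11 : 0 ≤ x₁₁ := by rw [h11]; exact mul_nonneg hγ' hbr
  have hx10 : 0 ≤ x₁₀ := by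
    rw [h10]; exact mul_nonneg (mul_nonneg (mul_nonneg hα0 hβ') hγ') hP02
  have hx00 : 0 ≤ x₀₀ := by rw [h00]; exact mul_nonneg hα' hP02
  have hbr' : 0 ≤ P₁ * (1 + α * (1 - β)) + P₀ * α :=
    add_nonneg (mul_nonneg hP₁ (add_nonneg zero_le_one (mul_nonneg hα0 hβ'))) (mul_nonneg hP₀ hα0)
  have hdet0 : 0 ≤ x₁₁ * (x₁₀ + x₀₀) - x₁₀ * (x₁₁ + x₀₁) := by
    rw [star_det h00 h01 h10 h11]
    exact mul_nonneg (mul_nonneg (mul_nonneg (mul_nonneg hγ' hα') hP02) hβ0) hbr'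
  have hD : 0 ≤ x₁₀ + x₀₀ := add_nonneg hx10 hx00
  rcases hD.lt_or_eq with hDpos | hD0
  · -- the denominator is positive: clear it
    have hrhs : x₁₁ - x₁₀ * (x₁₁ + x₀₁) / (x₁₀ + x₀₀) =
        (x₁₁ * (x₁₀ + x₀₀) - x₁₀ * (x₁₁ + x₀₁)) / (x₁₀ + x₀₀) := by
      rw [eq_div_iff hDpos.ne', sub_mul, div_mul_cancel₀ _ hDpos.ne']
    rw [hrhs, le_div_iff₀ hDpos]
    rcases le_or_gt (P₂ - P₁) 0 with hX | hX
    · rw [max_eq_left hX, mul_zero, zero_mul]; exact hdet0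
    · rw [max_eq_right hX.le]
      exact star_main_case hα0 hα1 hβ0 hβ1 hγ0 hγ1 hP₀ hP₁ hP₂ h00 h01 h10 h11 hord
  · -- the denominator vanishes: `PAX = x₁₁ ≥ 0` and `LOSS = 0`
    rw [← hD0, div_zero, sub_zero]
    have hx00' : x₀₀ = 0 := by linarith
    rw [h00] at hx00'
    rcases mul_eq_zero.1 hx00' with h | h
    · rw [h, zero_mul, zero_mul, zero_mul]; exact hx11
    · have hP₂ : P₂ = 0 := by linarith
      rw [hP₂, zero_sub, max_eq_left (neg_nonpos.2 hP₁), mul_zero]; exact hx11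

end StarAlgebra

section StarOrder

variable {V : Type*} {E : Type*} [Fintype E] [DecidableEq E] [Fintype V] [DecidableEq V]
  {R : Type*} [Field R] [LinearOrder R]

omit [Fintype E] [DecidableEq E] [Fintype V] [DecidableEq V] in
/-- `S₀` is symmetric in `a₁, a₂`. -/
lemma stateNone_comm (ends : E → Sym2 V) (o a₁ a₂ b : V) :
    stateNone ends o a₂ a₁ b = stateNone ends o a₁ a₂ b := by
  ext ω
  simp only [stateNone, Set.mem_setOf_eq]
  rw [conn_comm_iff (x := a₁) (y := a₂)]
  tauto

omit [Fintype V] [DecidableEq V] [LinearOrder R] in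
/-- `P(b ∈ U, a₁ ∉ U) = x₁₁ + x₀₁` (`U = C(a₂)`): split on `o ∈ U`. -/
lemma prob_connEvent_inter_compl_eq_cells (p : E → R) (ends : E → Sym2 V) (o a₁ a₂ b : V) :
    prob p (connEvent ends a₂ b ∩ (connEvent ends a₂ a₁)ᶜ) =
      prob p (connEvent ends o a₂ ∩ connEvent ends a₂ b ∩ (connEvent ends a₂ a₁)ᶜ) +
        prob p ((connEvent ends o a₂)ᶜ ∩ connEvent ends a₂ b ∩ (connEvent ends a₂ a₁)ᶜ) := by
  rw [← prob_inter_add_prob_inter_compl p (connEvent ends a₂ b ∩ (connEvent ends a₂ a₁)ᶜ)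
    (connEvent ends o a₂)]
  congr 2 <;> ext ω <;> simp only [Set.mem_inter_iff, Set.mem_compl_iff] <;> tauto

omit [Fintype V] [LinearOrder R] in
/-- `P(a₁, b ∉ U) = x₁₀ + x₀₀` (`U = C(a₂)`): split on `o ∈ U`. -/
lemma prob_avoidAll_eq_cells (p : E → R) (ends : E → Sym2 V) (o a₁ a₂ b : V) :
    prob p (avoidAll ends a₂ {a₁, b}) =
      prob p (connEvent ends o a₂ ∩ avoidAll ends a₂ {a₁, b}) +
        prob p ((connEvent ends o a₂)ᶜ ∩ avoidAll ends a₂ {a₁, b}) := by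
  rw [← prob_inter_add_prob_inter_compl p (avoidAll ends a₂ {a₁, b}) (connEvent ends o a₂),
    Set.inter_comm, Set.inter_comm (avoidAll ends a₂ {a₁, b})]

end StarOrder

section StarTheoremProof

variable {V : Type*} {E : Type*} [Fintype E] [DecidableEq E] [Fintype V] [DecidableEq V]
  {R : Type*} [Field R] [LinearOrder R] [IsStrictOrderedRing R]

/-- **The star-attached root theorem** for distinct `a₁, a₂, b` (§8.7 (9)). -/
theorem starTheorem_of_ne (p : E → R) (hp : IsProbVec p) (ends : E → Sym2 V) {o a₁ a₂ b : V}
    (h12 : a₁ ≠ a₂) (h1b : a₁ ≠ b) (h2b : a₂ ≠ b) (ho : o ∉ ({a₁, a₂, b} : Finset V)) :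
    StarTheorem p ends o a₁ a₂ b := by
  intro hS hord
  unfold H2Prime pax
  rw [lossTerm_star p hS ho h2b h12 h1b, prob_connEvent_inter_compl_eq_cells p ends o a₁ a₂ b,
    prob_avoidAll_eq_cells p ends o a₁ a₂ b]
  -- the order hypothesis through the swapped cells
  have hS' : StarAttached ends o {a₂, a₁, b} := by rwa [Finset.insert_comm]
  have ho' : o ∉ ({a₂, a₁, b} : Finset V) := by rwa [Finset.insert_comm]
  have hr := (connOrder_iff p ends a₁ a₂ b).1 hord
  rw [connEvent_inter_avoidAll_eq, prob_connEvent_inter_compl_eq_cells p ends o a₂ a₁ b,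
    prob_cell11 p ends hS' ho' h1b h12.symm h2b, prob_cell01 p ends hS' ho' h1b,
    stateNone_comm ends o a₁ a₂ b, prob_connEvent_inter_compl_eq_cells p ends o a₁ a₂ b] at hr
  exact star_algebra _ _ _ _ _ _ _ _ _ _ (prob_nonneg hp _) (prob_le_one hp _) (prob_nonneg hp _)
    (prob_le_one hp _) (prob_nonneg hp _) (prob_le_one hp _) (prob_nonneg hp _) (prob_nonneg hp _)
    (prob_nonneg hp _) (prob_cell00 p ends hS ho) (prob_cell01 p ends hS ho h2b)
    (prob_cell10 p ends hS ho h2b h12 h1b) (prob_cell11 p ends hS ho h2b h12 h1b) hr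

/-- The degenerate target `b = a₂`: `LOSS = 0 ≤ PAX`. -/
theorem h2PrimeOrdered_of_b_eq_a₂ (p : E → R) (hp : IsProbVec p) (ends : E → Sym2 V)
    (o a₁ a₂ : V) : H2PrimeOrdered p ends o a₁ a₂ a₂ := by
  intro _
  unfold H2Prime pax
  have hloss : lossTerm p ends o a₁ a₂ a₂ = 0 := by
    unfold lossTerm
    refine Finset.sum_eq_zero fun W _ => ?_
    have h1 : connDelEvent ends W a₂ a₂ = Set.univ :=
      Set.eq_univ_of_forall fun ω => conn_refl ends _ a₂
    rw [h1, prob_univ, max_eq_left (sub_nonpos.2 (prob_le_one hp _)), mul_zero]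
  have hav : avoidAll ends a₂ {a₁, a₂} = ∅ :=
    Set.eq_empty_of_forall_notMem fun ω h =>
      h a₂ (Finset.mem_insert_of_mem (Finset.mem_singleton_self _)) (conn_refl ends ω a₂)
  rw [hloss, hav, prob_empty, div_zero, sub_zero]
  exact prob_nonneg hp _

/-- The degenerate target `b = a₁`: under the order hypothesis `P(a₂ ↔ a₁) = 1`, so
`LOSS ≤ 0 = PAX`. -/
theorem h2PrimeOrdered_of_b_eq_a₁ (p : E → R) (hp : IsProbVec p) (ends : E → Sym2 V)
    (o a₁ a₂ : V) : H2PrimeOrdered p ends o a₁ a₂ a₁ := by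
  intro hord
  unfold H2Prime pax
  -- `PAX = 0`
  have e1 : connEvent ends o a₂ ∩ connEvent ends a₂ a₁ ∩ (connEvent ends a₂ a₁)ᶜ = ∅ := by
    rw [Set.inter_assoc, Set.inter_compl_self, Set.inter_empty]
  have e2 : connEvent ends a₂ a₁ ∩ (connEvent ends a₂ a₁)ᶜ = ∅ := Set.inter_compl_self _
  rw [e1, e2, prob_empty, mul_zero, zero_div, sub_zero]
  -- `P((a₂ ↔ a₁)ᶜ) = 0`
  have hone : prob p (connEvent ends a₂ a₁) = 1 := by
    unfold ConnOrder at hord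
    have : connEvent ends a₁ a₁ = Set.univ := Set.eq_univ_of_forall fun ω => conn_refl ends ω a₁
    rw [this, prob_univ] at hord
    exact le_antisymm (prob_le_one hp _) hord
  have hc : prob p (connEvent ends a₂ a₁)ᶜ = 0 := by rw [prob_compl, hone, sub_self]
  -- every term of `LOSS` is `≤ P(C(o) = W, (a₂ ↔ a₁)ᶜ) ≤ 0`
  unfold lossTerm
  refine Finset.sum_nonpos fun W hW => ?_
  have ha₂ : a₂ ∉ W := Finset.disjoint_right.1 (Finset.mem_filter.1 hW).2
    (Finset.mem_insert_of_mem (Finset.mem_singleton_self _))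
  have h1 : connDelEvent ends W a₁ a₁ = Set.univ :=
    Set.eq_univ_of_forall fun ω => conn_refl ends _ a₁
  rw [h1, prob_univ, max_eq_right (sub_nonneg.2 (prob_le_one hp _)), mul_sub, mul_one,
    ← prob_clusterEvent_inter_connEvent_eq_mul_connDel p ends o W ha₂]
  have h2 := prob_inter_add_prob_inter_compl p (clusterEvent ends o ↑W) (connEvent ends a₂ a₁)
  have h3 : prob p (clusterEvent ends o ↑W ∩ (connEvent ends a₂ a₁)ᶜ) ≤
      prob p (connEvent ends a₂ a₁)ᶜ := prob_mono hp Set.inter_subset_right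
  linarith

/-- **The star-attached root theorem** (§8.7 (9)): `N(o) ⊆ {a₁, a₂, b}` ⇒ (H2′) under the order
hypothesis, for every finite graph and every admissible `p` (`a₁ ≠ a₂`, `o ∉ {a₁, a₂, b}`). -/
theorem starTheorem (p : E → R) (hp : IsProbVec p) (ends : E → Sym2 V) {o a₁ a₂ b : V}
    (h12 : a₁ ≠ a₂) (ho1 : o ≠ a₁) (ho2 : o ≠ a₂) (hob : o ≠ b) :
    StarTheorem p ends o a₁ a₂ b := by
  by_cases h2b : b = a₂
  · subst h2b; exact fun _ => h2PrimeOrdered_of_b_eq_a₂ p hp ends o a₁ b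
  by_cases h1b : b = a₁
  · subst h1b; exact fun _ => h2PrimeOrdered_of_b_eq_a₁ p hp ends o b a₂
  refine starTheorem_of_ne p hp ends h12 (Ne.symm h1b) (Ne.symm h2b) ?_
  simp only [Finset.mem_insert, Finset.mem_singleton, not_or]
  exact ⟨ho1, ho2, hob⟩

end StarTheoremProof

section StarClosure

variable (R : Type) [Field R] [LinearOrder R] [IsStrictOrderedRing R]

/-- **`StarTheorem_all`**: the star-attached root theorem for every finite graph. -/
theorem starTheorem_all : StarTheorem_all R :=
  fun _ _ _ _ _ _ ends p hp _ _ _ _ h12 ho1 ho2 hob => starTheorem p hp ends h12 ho1 ho2 hob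

end StarClosure

end Summit.Ventures.PercRepro2
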